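import Literature.Algebra.EuclideanLattices.GaussianNoiseOneDim
import Literature.Algebra.EuclideanLattices.GaussianSublatticeUniformity
import Literature.Computability.Cryptography.LWENoise
import Literature.Computability.Cryptography.StatisticalDistanceMixtures
import Literature.Computability.Cryptography.StatisticalDistanceMapProofs
import Literature.Probability.Distributions.IndepProductLawDistance
import HarnessLib

/-!
# Regev 2009, Lemma 3.11: the `LWE` sample manufactured from a `BDD` instance and a discrete Gaussian sample is close to `A_{s,Ψ̄_β}`

Topic `Computability/Cryptography` (family `pqc`), grouping namespace `Regev2009`. This file PROVES the
distributional heart of the classical half of Regev's reduction — **Lemma 3.11** ("main procedure of the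
first part", inside Lemma 3.4 "first part of the iterative step") — which is also **Peikert's Prop. 3.2**
(STOC 2009) and hence the analytic core of the second component `h₂` of
`peikert_gapSVPZeta_to_lwe_classical_of_components` (`PeikertReduction.lean`, named fact
`Literature.Computability.Cryptography.peikert_gapSVPZeta_to_lwe_classical`, pqc.S20); the same lemma
sits inside Thm. 3.1 of Regev's quantum reduction (pqc.S19, hypothesis `hB`/`h₂` of
`RegevDGSReduction*.lean`). Everything here is PROVED: theorems, plus small definitions WITH BODIES
(the objects of the printed procedure); no named fact is introduced.

**The printed claim** (Regev 2009, proof of Lemma 3.11, arXiv:2401.03703 §3.2.1). Given `x` within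
distance `αp/(√2 r)` of `L*` (`κ = κ_{L*}(x)` the closest dual vector, `x' = x - κ`), `r > √2 p η_ε(L)`:
*"We sample a vector `v ∈ L` from `D_{L,r}`, and let `a = L⁻¹v mod p`. We then output
`(a, ⟨x, v⟩/p + e mod 1)` where `e ∈ ℝ` is chosen according to a normal distribution with standard
deviation `α/(2√π)`. We claim that the distribution given by this procedure is within negligible
statistical distance of `A_{s,Ψ_β}` for some `β ≤ α`"*, with `s = (L*)⁻¹κ_{L*}(x) mod p` and
`β = √((r‖x'‖/p)² + α²/2)`. The proof: (i) `a` is close to uniform because its classes are the cosets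
of `pL` and `η_ε(pL) = pη_ε(L) < r` (Claim 3.8); (ii) conditioned on `a`, `v ← D_{pL+La,r}`,
`⟨x, v⟩/p + e = ⟨x'/p, v⟩ + e + ⟨κ, v⟩/p`, `⟨κ, v⟩ ≡ ⟨s, a⟩ (mod p)` (integrality of the pairing
`L* × L → ℤ`), and `⟨x'/p, v⟩ + e ≈_{4ε} Ψ_β` by Corollary 3.10.

## Main result

* `Regev2009.tvDist_bddLWESample_lweSample_le` — **Lemma 3.11's claim, discretised and with explicit
  constants**: for a full-rank lattice `L ⊆ E` with `ℤ`-basis `b`, a modulus `p ≥ 1`, `0 < ε ≤ 1/2`,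
  `√2·p·η_ε(L) ≤ r`, `0 < α₀`, `κ ∈ L*`, `r‖x - κ‖ ≤ α₀p`:
  `Δ( law of (L⁻¹v mod p, ⌊p(⟪x,v⟫/p + e)⌉ mod p) , A_{s,Ψ̄_β} ) ≤ 6ε`
  (`v ← D_{L,r}`, `e ∼ N(0, α₀²/(2π))`; `A_{s,χ} = LWE.lweSample χ s`, `Ψ̄_β = LWE.discretizedGaussian p β`,
  `s = secretOf b p κ`, `β = √((r‖x - κ‖/p)² + α₀²)`); `Regev2009.noiseParam_le`: `β ≤ √2 α₀`.
  Regev's parameters are `α₀ = α/√2` (his `e` has standard deviation `α/(2√π) = (α/√2)/√(2π)`), giving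
  his `β = √((r‖x'‖/p)² + α²/2) ≤ α`; "negligible" is `6ε` for the negligible `ε` of Lemma 3.4.

## The objects (definitions with bodies, LOCAL GLUE) and the steps (all PROVED)

* `Regev2009.coeffMod b p : L →+ ℤ_pⁿ` — `v ↦ L⁻¹v mod p`; `coeffMod_surjective`; its kernel is the
  sublattice `Regev2009.smulLattice b p = pL = L(p·b)` (`coeffMod_eq_zero_iff`, `mem_smulLattice_iff`:
  `x ∈ pL ↔ p⁻¹x ∈ L`, `smulLattice_le : pL ≤ L`), a full-rank lattice (`ZSpan` instances) with
  `(pL)* = p⁻¹L*` (`mem_dualLattice_smulLattice_iff`) and **`η_ε(pL) ≤ pη_ε(L)`**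
  (`smoothingParameter_smulLattice_le`, from `gaussianMass_dualLattice_smulLattice`).
* `Regev2009.secretOf b p κ` — `s = (L*)⁻¹κ mod p`, `sᵢ = ⟪κ, bᵢ⟫ mod p`; `inner_coe_eq_intCast_sum`
  (`⟪κ, v⟫ = ∑ (L⁻¹v)ᵢ ⟪κ, bᵢ⟫ ∈ ℤ` for `κ ∈ L*`), `intCast_sum_eq_dotProduct` (`≡ ⟨a, s⟩ mod p`),
  `discretize_inner_div_add` (`⌊p(⟪x,v⟫/p + e)⌉ ≡ ⟨a, s⟩ + ⌊p(⟪x'/p, v⟫ + e)⌉ (mod p)`).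
* `Regev2009.noiseZMod p α₀ c` — the law of `⌊p(c + e)⌉ mod p`, `e ∼ N(0, α₀²/(2π))` (`= Ψ̄_{α₀}` at
  `c = 0`, `noiseZMod_zero`); `Regev2009.bddLWESample b p x r α₀` — the law of the manufactured sample.
* `Regev2009.discreteGaussian_eq_bind_fibre` — disintegration of `D_{L,s,t}` along a homomorphism with
  lattice kernel: class `a`, then `D_{L₀,s,t-rep a}` on the coset ("the distribution of `v` is
  `D_{pL+La,r}`"); `bddLWESample_eq_bind`, `lweSample_eq_bind`.
* Statistical-distance glue (dot-notation on `PMF`): `tvDist_le_of_forall_toOuterMeasure_sub_le`,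
  `tvDist_toPMF_le_of_forall` (event-wise bounds); the mixture bounds `PMF.tvDist_bind_left_le`
  (`Δ(μ >>= F, μ' >>= F) ≤ Δ(μ, μ')`) and `PMF.tvDist_bind_le_of_forall_le` are the tree's
  (`Probability/Distributions/IndepProductLawDistance.lean`).
* Step (i): the tree's GPV smoothing lemma `tvDist_map_discreteGaussian_uniformOfFintype_le_two_mul`
  (`GaussianSublatticeUniformity.lean`) over `pL ≤ L` with `η_ε(pL) ≤ r`: `Δ(law a, U) ≤ 2ε`.
  Step (ii): `Regev2009.tvDist_noise_fibre_le` — per class, `Δ ≤ 4ε` from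
  `Regev2009.corollary_3_10` (`GaussianNoiseOneDim.lean`) on the coset `w + pL` with `z = x'/p`, whose
  hypothesis `η_ε(pL) ≤ 1/√(1/r² + (‖z‖/α₀)²)` is `smoothingParameter_smulLattice_le_one_div_sqrt`
  (Regev: "`1/√(1/r² + (√2‖x'‖/pα)²) ≥ r/√2 > η_ε(pL)`"). Triangle inequality: `2ε + 4ε`.

## Faithfulness notes

* The second component is DISCRETISED (`⌊p·⌉ mod p`, Regev 2009 §2, `Ψ ↦ Ψ̄`; tree: `LWE.discretize`,
  `LWE.discretizedGaussian`) because the tree's `LWE` oracles (`Oracle.SolvesSearchLWE`, pqc.S19/S20)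
  take samples in `ℤ_pⁿ × ℤ_p`; the torus statement is recovered verbatim by the same proof with
  `discretize` replaced by the quotient map (both are "applying a function", under which statistical
  distance cannot increase). The integrality `⟨κ, v⟩ ∈ ℤ` makes the discretisation commute with the
  split `⟨x, v⟩ = ⟨κ, v⟩ + ⟨x', v⟩` exactly (`discretize_intCast_div_add`).
* `v ← D_{L,r}` is exact here; a sampler within statistical distance `δ` of `D_{L,r}` (GPV, Peikert's
  Prop. 2.8) costs an extra `δ` by `PMF.tvDist_bind_left_le` (tree). Several samples: the samples are
  independent given `x`, so `N` samples are within `N·(6ε + δ)` of `A_{s,Ψ̄_β}^N` (hybrid argument, to be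
  done by the consumer with the tree's `LWE.iidPMF`).
* `β` depends on the unknown `‖x'‖` (Regev's Lemma 3.7 handles "unknown `β ≤ α`"); `noiseParam_le`
  records `β ≤ √2α₀`.
* Orientation for Peikert's Prop. 3.2 (BDD on `Λ = L(B)`, samples from `D_{Λ*,r}`): instantiate `L := Λ*`
  (so `L* = Λ ∋ κ`, `dualLattice_dualLattice`) with any `ℤ`-basis `b` of `Λ*` (e.g. the dual basis of
  `B`, `dualLattice_eq_span_dualBasis`); then `sᵢ = ⟪κ, bᵢ⟫ mod p` are the `B`-coordinates of `κ`.

## References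

* O. Regev, *On lattices, learning with errors, random linear codes, and cryptography*, J. ACM 56
  (2009), art. 34 = arXiv:2401.03703: §2 (`Ψ_α`, `Ψ̄_α`, `A_{s,χ}`), Lemma 3.4, Claim 3.8, Corollary
  3.10, Lemma 3.11 and its proof (§3.2.1) [RegevLWE2009] (held; `lit read arxiv:2401.03703`, chunks
  p0016–p0018).
* C. Peikert, *Public-key cryptosystems from the worst-case shortest vector problem*, STOC 2009,
  Prop. 3.2 (= Regev's Lemma 3.4 with `L ↔ L*`) [Peikert2009].
* C. Gentry, C. Peikert, V. Vaikuntanathan, *Trapdoors for hard lattices and new cryptographic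
  constructions*, STOC 2008, §2 (smoothing over a sublattice; tree: `GaussianSublatticeUniformity.lean`)
  [GentryPeikertVaikuntanathan2008].
-/

noncomputable section

open MeasureTheory ProbabilityTheory Module Literature.Algebra.EuclideanLattices
open scoped Real ENNReal InnerProductSpace NNReal

/-! ### Statistical distance glue (dot-notation extensions of `PMF`) -/

namespace PMF

variable {α β Ω : Type*}

/-- An event-wise bound gives a bound on the statistical distance:
if `P(S) - Q(S) ≤ δ` for every `S` then `Δ(P, Q) ≤ δ`. [folklore] -/
theorem tvDist_le_of_forall_toOuterMeasure_sub_le (P Q : PMF α) {δ : ℝ}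
    (h : ∀ S : Set α, (P.toOuterMeasure S).toReal - (Q.toOuterMeasure S).toReal ≤ δ) :
    P.tvDist Q ≤ δ := by
  rw [tvDist_eq_iSup_measure_holds]
  exact ciSup_le h

/-- The statistical distance of two laws on a countable measurable space obtained from probability
measures, bounded event-wise: if `μ(S) - ν(S) ≤ δ` for all measurable `S`, then
`Δ(μ.toPMF, ν.toPMF) ≤ δ`. [folklore] -/
theorem tvDist_toPMF_le_of_forall {α : Type*} [Countable α] [MeasurableSpace α]
    [MeasurableSingletonClass α] (μ ν : Measure α) [IsProbabilityMeasure μ] [IsProbabilityMeasure ν]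
    {δ : ℝ} (h : ∀ S : Set α, MeasurableSet S → μ.real S - ν.real S ≤ δ) :
    μ.toPMF.tvDist ν.toPMF ≤ δ := by
  refine tvDist_le_of_forall_toOuterMeasure_sub_le _ _ fun S => ?_
  have hS : MeasurableSet S := S.to_countable.measurableSet
  have h1 : ∀ (ρ : Measure α) [IsProbabilityMeasure ρ], (ρ.toPMF.toOuterMeasure S).toReal = ρ.real S := by
    intro ρ _
    rw [← PMF.toMeasure_apply_eq_toOuterMeasure_apply (p := ρ.toPMF) hS, Measure.toPMF_toMeasure,
      measureReal_def]
  rw [h1 μ, h1 ν]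
  exact h S hS

end PMF

namespace Literature.Computability.Cryptography

namespace Regev2009

/-! ### Disintegration of a discrete Gaussian along a homomorphism with lattice kernel -/

section Fibre

variable {E : Type*} [NormedAddCommGroup E] [NormedSpace ℝ E] [FiniteDimensional ℝ E]
variable {L₀ L : Submodule ℤ E} [DiscreteTopology L₀] [DiscreteTopology L]
variable {G : Type*} [AddCommGroup G]

/-- **Disintegration of `D_{L,s,t}` along `φ`.** For `L₀ ≤ L`, a homomorphism `φ : L →+ G` with
kernel `L₀`, a section `rep` of `φ` and `0 < s`: drawing `v ← D_{L,s,t}` is the same as drawing its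
class `a = φ v` (law `φ_* D_{L,s,t}`) and then `v = y + rep a` with `y ← D_{L₀,s,t - rep a}` — the
conditional law of `v` given `φ v = a` is the discrete Gaussian of the same width on the coset
`rep a + L₀` (Regev 2009, proof of Lemma 3.11: "the distribution of `v` is `D_{pL+La,r}` (since we are
conditioning on `a`)"). [cite: RegevLWE2009, Lemma 3.11 (proof)] -/
theorem discreteGaussian_eq_bind_fibre (hL : L₀ ≤ L) (φ : L →+ G)
    (hker : ∀ x : L, φ x = 0 ↔ (x : E) ∈ L₀) (rep : G → L) (hrep : ∀ a, φ (rep a) = a) {s : ℝ}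
    (hs : 0 < s) (t : E) :
    discreteGaussian L s t = ((discreteGaussian L s t).map φ).bind fun a =>
      (discreteGaussian L₀ s (t - rep a)).map fun y => ⟨(y : E) + rep a, add_mem (hL y.2) (rep a).2⟩ := by
  classical
  refine PMF.ext fun v => ?_
  rw [PMF.bind_apply, tsum_eq_single (φ v)]
  · -- the class of `v`: `P(φ v) · D_{L₀,s,t - rep(φ v)}(v - rep (φ v)) = D_{L,s,t}(v)`
    have hy : (v : E) - rep (φ v) ∈ L₀ := by
      rw [← Submodule.coe_sub, ← hker, map_sub, hrep, sub_self]
    set y : L₀ := ⟨(v : E) - rep (φ v), hy⟩ with hydef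
    have hmap : ((discreteGaussian L₀ s (t - rep (φ v))).map fun y : L₀ =>
        (⟨(y : E) + rep (φ v), add_mem (hL y.2) (rep (φ v)).2⟩ : L)) v =
        discreteGaussian L₀ s (t - rep (φ v)) y := by
      rw [PMF.map_apply, tsum_eq_single y]
      · rw [if_pos]
        apply Subtype.ext
        simp [hydef]
      · intro y' hy'
        rw [if_neg]
        intro h
        apply hy'
        apply Subtype.ext
        have h' := congrArg (fun w : L => (w : E)) h
        simp only at h'
        change (y' : E) = (v : E) - rep (φ v)
        rw [h']
        abel
    rw [hmap, map_discreteGaussian_hom_apply hL φ hker hs t (hrep (φ v)),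
      discreteGaussian_apply L₀ hs, discreteGaussian_apply L hs]
    have hne0 : gaussianMass s (t - rep (φ v)) (L₀ : Set E) ≠ 0 := gaussianMass_lattice_ne_zero L₀ s _
    have hnet : gaussianMass s (t - rep (φ v)) (L₀ : Set E) ≠ ∞ := gaussianMass_lattice_ne_top L₀ hs.ne' _
    have harg : ((y : L₀) : E) - (t - rep (φ v)) = (v : E) - t := by
      simp only [hydef]
      abel
    rw [harg]
    set A : ℝ≥0∞ := ENNReal.ofReal (gaussianFunction s ((v : E) - t))
    set M : ℝ≥0∞ := gaussianMass s (t - rep (φ v)) (L₀ : Set E)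
    set Z : ℝ≥0∞ := gaussianMass s t (L : Set E)
    calc A * Z⁻¹ = A * Z⁻¹ * (M * M⁻¹) := by rw [ENNReal.mul_inv_cancel hne0 hnet, mul_one]
      _ = M * Z⁻¹ * (A * M⁻¹) := by ring
  · -- other classes do not charge `v`
    intro a ha
    have h0 : ((discreteGaussian L₀ s (t - rep a)).map fun y : L₀ =>
        (⟨(y : E) + rep a, add_mem (hL y.2) (rep a).2⟩ : L)) v = 0 := by
      rw [PMF.map_apply, ENNReal.tsum_eq_zero]
      intro y'
      rw [if_neg]
      intro h
      apply ha
      have hv : v = (⟨(y' : E), hL y'.2⟩ : L) + rep a := by rw [h]; rfl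
      rw [hv, map_add, hrep, (hker _).2 y'.2, zero_add]
    rw [h0, mul_zero]

end Fibre

/-! ### The coefficient map `v ↦ L⁻¹v mod p` -/

section CoeffMod

variable {E : Type*} [AddCommGroup E] {L : Submodule ℤ E} {ι : Type*} (b : Basis ι ℤ L) (p : ℕ)

/-- **The coefficient map `v ↦ L⁻¹v mod p`** (Regev 2009, proof of Lemma 3.11: "`a = L⁻¹v mod p`"): the
`b`-coordinates of `v ∈ L` reduced modulo `p`, a homomorphism `L →+ ℤ_pⁿ`. [cite: RegevLWE2009, Lemma 3.11 (proof)] -/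
def coeffMod : L →+ (ι → ZMod p) where
  toFun v i := ((b.repr v i : ℤ) : ZMod p)
  map_zero' := by funext i; simp
  map_add' v w := by funext i; simp

/-- Unfolding. [folklore] -/
theorem coeffMod_apply (v : L) (i : ι) : coeffMod b p v i = ((b.repr v i : ℤ) : ZMod p) := rfl

variable [Fintype ι] [NeZero p] in
/-- `v ↦ L⁻¹v mod p` is onto `ℤ_pⁿ` (take `v = ∑ aᵢ bᵢ` with `aᵢ ∈ [0, p)`). [folklore] -/
theorem coeffMod_surjective : Function.Surjective (coeffMod b p) := by
  intro g
  refine ⟨b.equivFun.symm fun i => ((g i).val : ℤ), funext fun i => ?_⟩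
  rw [coeffMod_apply, ← Basis.equivFun_apply, LinearEquiv.apply_symm_apply, Int.cast_natCast,
    ZMod.natCast_zmod_val]

end CoeffMod

/-! ### The sublattice `pL` and `η_ε(pL) ≤ p η_ε(L)` -/

section SmulLattice

variable {E : Type*} [NormedAddCommGroup E] [InnerProductSpace ℝ E] [FiniteDimensional ℝ E]
variable {L : Submodule ℤ E} [DiscreteTopology L] [IsZLattice ℝ L]
variable {ι : Type*} [Finite ι] (b : Basis ι ℤ L) (p : ℕ) [NeZero p]

/-- LOCAL GLUE. The real basis `p·b = (p b₁, …, p bₙ)` of `E`, for a `ℤ`-basis `b` of the full-rank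
lattice `L` and a modulus `p ≥ 1`. [folklore] -/
def smulBasis : Basis ι ℝ E :=
  (b.ofZLatticeBasis ℝ L).unitsSMul fun _ => Units.mk0 (p : ℝ) (NeZero.ne (p : ℝ))

omit [Finite ι] in
/-- `(p·b)ᵢ = p bᵢ`. [folklore] -/
theorem smulBasis_apply (i : ι) : smulBasis b p i = (p : ℝ) • ((b i : L) : E) := by
  rw [smulBasis, Basis.unitsSMul_apply, Basis.ofZLatticeBasis_apply]
  rfl

omit [Finite ι] in
/-- Coordinates in the basis `p·b` are the coordinates in `b` divided by `p`. [folklore] -/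
theorem smulBasis_repr_apply (x : E) (i : ι) :
    (smulBasis b p).repr x i = (p : ℝ)⁻¹ * (b.ofZLatticeBasis ℝ L).repr x i := by
  rw [smulBasis, Basis.repr_unitsSMul, Units.smul_def, smul_eq_mul]
  congr 1

/-- LOCAL GLUE. The sublattice `pL = {p v | v ∈ L} = L(p·b)` of `L` (Regev 2009, proof of
Lemma 3.11: the kernel of `v ↦ L⁻¹v mod p`), as the `ℤ`-span of the real basis `p·b` — so that
Mathlib's `ZSpan` instances make it a full-rank lattice. [cite: RegevLWE2009, Lemma 3.11 (proof)] -/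
def smulLattice : Submodule ℤ E := Submodule.span ℤ (Set.range (smulBasis b p))

/-- `pL` is discrete (Mathlib's `ZSpan` instance for the span of a real basis). [folklore] -/
instance instDiscreteTopologySmulLattice : DiscreteTopology (smulLattice b p) := by
  unfold smulLattice; infer_instance

/-- `pL` is a full-rank lattice (Mathlib's `ZSpan` instance for the span of a real basis). [folklore] -/
instance instIsZLatticeSmulLattice : IsZLattice ℝ (smulLattice b p) := by
  unfold smulLattice; infer_instance

omit [Finite ι] in
/-- `p⁻¹ k` is an integer iff `p ∣ k`. [folklore] -/
theorem inv_mul_intCast_mem_range_iff (k : ℤ) :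
    (p : ℝ)⁻¹ * (k : ℝ) ∈ Set.range (algebraMap ℤ ℝ) ↔ (p : ℤ) ∣ k := by
  have hp : (p : ℝ) ≠ 0 := NeZero.ne (p : ℝ)
  constructor
  · rintro ⟨m, hm⟩
    rw [eq_intCast] at hm
    refine ⟨m, ?_⟩
    have h : (k : ℝ) = (p : ℝ) * m := by
      rw [hm, ← mul_assoc, mul_inv_cancel₀ hp, one_mul]
    exact_mod_cast h
  · rintro ⟨m, rfl⟩
    refine ⟨m, ?_⟩
    rw [eq_intCast]
    push_cast
    rw [← mul_assoc, inv_mul_cancel₀ hp, one_mul]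

omit [Finite ι] in
/-- **Membership in `pL`**: `x ∈ pL ↔ p⁻¹x ∈ L`. [folklore] -/
theorem mem_smulLattice_iff (x : E) : x ∈ smulLattice b p ↔ (p : ℝ)⁻¹ • x ∈ L := by
  have key : (p : ℝ)⁻¹ • x ∈ L ↔
      (p : ℝ)⁻¹ • x ∈ Submodule.span ℤ (Set.range (b.ofZLatticeBasis ℝ L)) := by
    rw [b.ofZLatticeBasis_span ℝ L]
  rw [key, smulLattice, Basis.mem_span_iff_repr_mem, Basis.mem_span_iff_repr_mem]
  simp only [smulBasis_repr_apply, map_smul, Finsupp.smul_apply, smul_eq_mul]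

omit [Finite ι] in
/-- For a lattice vector `v ∈ L`: `v ∈ pL ↔ p` divides every `b`-coordinate of `v`. [folklore] -/
theorem coe_mem_smulLattice_iff (v : L) : (v : E) ∈ smulLattice b p ↔ ∀ i, (p : ℤ) ∣ b.repr v i := by
  rw [smulLattice, Basis.mem_span_iff_repr_mem]
  simp only [smulBasis_repr_apply, Basis.ofZLatticeBasis_repr_apply, inv_mul_intCast_mem_range_iff]

omit [Finite ι] in
/-- `pL ≤ L`. [folklore] -/
theorem smulLattice_le : smulLattice b p ≤ L := by
  rw [smulLattice, Submodule.span_le]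
  rintro _ ⟨i, rfl⟩
  rw [smulBasis_apply, Nat.cast_smul_eq_nsmul]
  exact nsmul_mem (b i).2 p

omit [Finite ι] in
/-- The kernel of `v ↦ L⁻¹v mod p` is `pL`. [cite: RegevLWE2009, Lemma 3.11 (proof)] -/
theorem coeffMod_eq_zero_iff (v : L) : coeffMod b p v = 0 ↔ (v : E) ∈ smulLattice b p := by
  rw [coe_mem_smulLattice_iff, funext_iff]
  simp only [coeffMod_apply, Pi.zero_apply, ZMod.intCast_zmod_eq_zero_iff_dvd]

omit [Finite ι] in
/-- **Dual of `pL`**: `y ∈ (pL)* ↔ p y ∈ L*`. [folklore] -/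
theorem mem_dualLattice_smulLattice_iff (y : E) :
    y ∈ dualLattice (smulLattice b p) ↔ (p : ℝ) • y ∈ dualLattice L := by
  have hp : (p : ℝ) ≠ 0 := NeZero.ne (p : ℝ)
  rw [mem_dualLattice, mem_dualLattice]
  constructor
  · intro h w hw
    have hpw : (p : ℝ) • w ∈ smulLattice b p := by
      rw [mem_smulLattice_iff, smul_smul, inv_mul_cancel₀ hp, one_smul]; exact hw
    obtain ⟨m, hm⟩ := h _ hpw
    exact ⟨m, by rw [hm, real_inner_smul_left, real_inner_smul_right]⟩
  · intro h w hw
    rw [mem_smulLattice_iff] at hw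
    obtain ⟨m, hm⟩ := h _ hw
    refine ⟨m, ?_⟩
    rw [hm, real_inner_smul_left, real_inner_smul_right, ← mul_assoc, mul_inv_cancel₀ hp, one_mul]

omit [Finite ι] in
/-- The dual Gaussian mass of `pL` at width `1/(p s)` is the dual Gaussian mass of `L` at width `1/s`
(`(pL)* = p⁻¹L*` and `ρ_{1/(ps)}(p⁻¹w) = ρ_{1/s}(w)`). [folklore] -/
theorem gaussianMass_dualLattice_smulLattice {s : ℝ} (hs : 0 < s) :
    gaussianMass (1 / (p * s)) 0 ((dualLattice (smulLattice b p) : Set E) \ {0}) =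
      gaussianMass (1 / s) 0 ((dualLattice L : Set E) \ {0}) := by
  have hp : (p : ℝ) ≠ 0 := NeZero.ne (p : ℝ)
  -- the bijection `y ↦ p y`
  have hto : ∀ y : E, y ∈ (dualLattice (smulLattice b p) : Set E) \ {0} →
      (p : ℝ) • y ∈ (dualLattice L : Set E) \ {0} := fun y hy =>
    ⟨(mem_dualLattice_smulLattice_iff b p y).1 hy.1, by
      simpa [smul_eq_zero, hp] using hy.2⟩
  have hfrom : ∀ w : E, w ∈ (dualLattice L : Set E) \ {0} →
      (p : ℝ)⁻¹ • w ∈ (dualLattice (smulLattice b p) : Set E) \ {0} := fun w hw =>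
    ⟨(mem_dualLattice_smulLattice_iff b p _).2 (by
      rw [smul_smul, mul_inv_cancel₀ hp, one_smul]; exact hw.1), by
      simpa [smul_eq_zero, hp] using hw.2⟩
  let e : ((dualLattice (smulLattice b p) : Set E) \ {0} : Set E) ≃ ((dualLattice L : Set E) \ {0} : Set E) :=
    { toFun := fun y => ⟨(p : ℝ) • (y : E), hto y y.2⟩
      invFun := fun w => ⟨(p : ℝ)⁻¹ • (w : E), hfrom w w.2⟩
      left_inv := fun y => Subtype.ext (by simp [smul_smul, inv_mul_cancel₀ hp])
      right_inv := fun w => Subtype.ext (by simp [smul_smul, mul_inv_cancel₀ hp]) }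
  unfold gaussianMass
  rw [← Equiv.tsum_eq e]
  refine tsum_congr fun y => ?_
  simp only [sub_zero]
  change ENNReal.ofReal (gaussianFunction (1 / (p * s)) (y : E)) =
    ENNReal.ofReal (gaussianFunction (1 / s) ((p : ℝ) • (y : E)))
  rw [show (1 / s : ℝ) = p * (1 / (p * s)) by field_simp, gaussianFunction_smul _ hp]

omit [Finite ι] in
/-- **`η_ε(pL) ≤ p · η_ε(L)`** (in fact equality; Regev 2009, proof of Lemma 3.11: "using
`η_ε(pL) = p η_ε(L)`"): if `ρ_{1/s}(L* ∖ {0}) ≤ ε` then `ρ_{1/(ps)}((pL)* ∖ {0}) ≤ ε`. [cite: RegevLWE2009, Lemma 3.11 (proof)] -/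
theorem smoothingParameter_smulLattice_le {ε : ℝ} (hε : 0 < ε) :
    smoothingParameter (smulLattice b p) ε ≤ p * smoothingParameter L ε := by
  have hp : (0 : ℝ) < p := Nat.cast_pos.2 (Nat.pos_of_ne_zero (NeZero.ne p))
  suffices h : smoothingParameter (smulLattice b p) ε / p ≤ smoothingParameter L ε by
    rwa [div_le_iff₀ hp, mul_comm] at h
  rw [le_smoothingParameter_iff_holds L hε]
  intro s hs hmass
  rw [div_le_iff₀ hp]
  unfold smoothingParameter
  refine csInf_le ⟨0, fun w hw => hw.1.le⟩ ⟨by positivity, ?_⟩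
  rw [show s * (p : ℝ) = p * s by ring, gaussianMass_dualLattice_smulLattice b p hs]
  exact hmass

end SmulLattice

/-! ### The secret, the noise modulo `p`, and the manufactured sample -/

section Sample

variable {E : Type*} [NormedAddCommGroup E] [InnerProductSpace ℝ E] [FiniteDimensional ℝ E]
variable {L : Submodule ℤ E} [DiscreteTopology L]
variable {ι : Type} [Fintype ι] (b : Basis ι ℤ L) (p : ℕ) [NeZero p]

/-- **The secret** `s = (L*)⁻¹κ mod p` of Regev's Lemma 3.11: the coefficient vector of the closest
dual-lattice vector `κ = κ_{L*}(x)` in the dual basis `b^∨`, reduced modulo `p`; its `i`-th coefficient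
is `⟪κ, bᵢ⟫ ∈ ℤ` (read off the real number `⟪κ, bᵢ⟫` by rounding, exact for `κ ∈ L*`).
[cite: RegevLWE2009, Lemma 3.11 (proof: "`s = (L*)⁻¹κ_{L*}(x) mod p`")] -/
def secretOf (κ : E) : ι → ZMod p := fun i => ((round (⟪κ, ((b i : L) : E)⟫_ℝ) : ℤ) : ZMod p)

omit [FiniteDimensional ℝ E] [DiscreteTopology L] [NeZero p] in
/-- **Integrality of the pairing** (Regev 2009, proof of Lemma 3.11: "`⟨κ_{L*}(x), v⟩ =
⟨(L*)⁻¹κ_{L*}(x), L⁻¹v⟩` since `L⁻¹ = (L*)ᵀ` … the inner product between the corresponding coefficient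
vectors. Since the coefficient vectors are integer …"): for `κ ∈ L*` and `v ∈ L`,
`⟪κ, v⟫ = ∑ᵢ (L⁻¹v)ᵢ · ⟪κ, bᵢ⟫` with every `⟪κ, bᵢ⟫ = round ⟪κ, bᵢ⟫ ∈ ℤ`. [cite: RegevLWE2009, Lemma 3.11 (proof)] -/
theorem inner_coe_eq_intCast_sum {κ : E} (hκ : κ ∈ dualLattice L) (v : L) :
    ⟪κ, (v : E)⟫_ℝ = ((∑ i, b.repr v i * round (⟪κ, ((b i : L) : E)⟫_ℝ) : ℤ) : ℝ) := by
  have hint : ∀ i, ((round (⟪κ, ((b i : L) : E)⟫_ℝ) : ℤ) : ℝ) = ⟪κ, ((b i : L) : E)⟫_ℝ := by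
    intro i
    obtain ⟨m, hm⟩ := mem_dualLattice.1 hκ _ (b i).2
    rw [← hm, round_intCast]
  conv_lhs => rw [← b.sum_repr v]
  rw [Submodule.coe_sum, inner_sum]
  push_cast
  refine Finset.sum_congr rfl fun i _ => ?_
  rw [← Int.cast_smul_eq_zsmul ℝ, real_inner_smul_right, hint]

omit [FiniteDimensional ℝ E] [DiscreteTopology L] [NeZero p] in
/-- Modulo `p`, the integer `⟪κ, v⟫` is `⟨L⁻¹v mod p, s⟩ = ⟨a, s⟩` (Regev 2009, proof of Lemma 3.11:
"`⟨κ_{L*}(x), v⟩ mod p = ⟨s, a⟩ mod p`"). [cite: RegevLWE2009, Lemma 3.11 (proof)] -/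
theorem intCast_sum_eq_dotProduct (κ : E) (v : L) :
    ((∑ i, b.repr v i * round (⟪κ, ((b i : L) : E)⟫_ℝ) : ℤ) : ZMod p) =
      coeffMod b p v ⬝ᵥ secretOf b p κ := by
  unfold dotProduct secretOf
  push_cast
  refine Finset.sum_congr rfl fun i _ => ?_
  rw [coeffMod_apply]

omit [NeZero p] in
/-- Discretisation is additive over `p⁻¹ℤ`: `⌊p(k/p + w)⌉ = k + ⌊p w⌉`, so
`discretize p (k/p + w) = k + discretize p w` in `ℤ_p`. [folklore] -/
theorem discretize_intCast_div_add [NeZero p] (k : ℤ) (w : ℝ) :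
    LWE.discretize p ((k : ℝ) / p + w) = (k : ZMod p) + LWE.discretize p w := by
  have hp : (p : ℝ) ≠ 0 := NeZero.ne (p : ℝ)
  unfold LWE.discretize
  rw [mul_add, mul_div_cancel₀ _ hp, round_intCast_add, Int.cast_add]

omit [FiniteDimensional ℝ E] [DiscreteTopology L] in
/-- **Splitting the second component** (Regev 2009, proof of Lemma 3.11: "`⟨x, v⟩/p + e mod 1 =
⟨x'/p, v⟩ + e + ⟨κ_{L*}(x), v⟩/p mod 1`" with `x' = x - κ_{L*}(x)`), in discretised form: for `κ ∈ L*`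
and `v ∈ L`, `⌊p(⟪x, v⟫/p + e)⌉ mod p = ⟨L⁻¹v mod p, s⟩ + ⌊p(⟪x'/p, v⟫ + e)⌉ mod p`. [cite: RegevLWE2009, Lemma 3.11 (proof)] -/
theorem discretize_inner_div_add {x κ : E} (hκ : κ ∈ dualLattice L) (v : L) (e : ℝ) :
    LWE.discretize p (⟪x, (v : E)⟫_ℝ / p + e) =
      coeffMod b p v ⬝ᵥ secretOf b p κ +
        LWE.discretize p (⟪(p : ℝ)⁻¹ • (x - κ), (v : E)⟫_ℝ + e) := by
  have hp : (p : ℝ) ≠ 0 := NeZero.ne (p : ℝ)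
  have hsplit : ⟪x, (v : E)⟫_ℝ / p + e =
      ((∑ i, b.repr v i * round (⟪κ, ((b i : L) : E)⟫_ℝ) : ℤ) : ℝ) / p +
        (⟪(p : ℝ)⁻¹ • (x - κ), (v : E)⟫_ℝ + e) := by
    rw [← inner_coe_eq_intCast_sum b hκ v, real_inner_smul_left, inner_sub_left]
    field_simp
    ring
  rw [hsplit, discretize_intCast_div_add, intCast_sum_eq_dotProduct]

/-- LOCAL GLUE. The law of `⌊p(c + e)⌉ mod p` for `e ∼ N(0, α₀²/(2π))` (a normal variable "with
standard deviation `α₀/√(2π)`" in the language of Regev 2009), as a probability mass function on `ℤ_p`;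
for `c = 0` this is the tree's `Ψ̄_{α₀} = LWE.discretizedGaussian p α₀` (`noiseZMod_zero`). [cite: RegevLWE2009, §2 (`Ψ̄_α`) and Lemma 3.11 (proof)] -/
def noiseZMod (α₀ c : ℝ) : PMF (ZMod p) :=
  haveI : IsProbabilityMeasure ((gaussianReal 0 (Real.toNNReal (α₀ ^ 2 / (2 * π)))).map
      fun e => LWE.discretize p (c + e)) :=
    Measure.isProbabilityMeasure_map
      ((LWE.measurable_discretize p).comp (measurable_const_add c)).aemeasurable
  ((gaussianReal 0 (Real.toNNReal (α₀ ^ 2 / (2 * π)))).map fun e => LWE.discretize p (c + e)).toPMF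

omit [NeZero p] in
/-- Events under `noiseZMod`: `Pr[⌊p(c + e)⌉ mod p ∈ S] = N(0, α₀²/(2π)){e | ⌊p(c + e)⌉ mod p ∈ S}`.
[folklore] -/
theorem toReal_toOuterMeasure_noiseZMod [NeZero p] (α₀ c : ℝ) (S : Set (ZMod p)) :
    ((noiseZMod p α₀ c).toOuterMeasure S).toReal =
      (gaussianReal 0 (Real.toNNReal (α₀ ^ 2 / (2 * π)))).real
        ((fun e => LWE.discretize p (c + e)) ⁻¹' S) := by
  have hS : MeasurableSet S := S.to_countable.measurableSet
  have hmeas : Measurable fun e => LWE.discretize p (c + e) :=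
    (LWE.measurable_discretize p).comp (measurable_const_add c)
  haveI : IsProbabilityMeasure ((gaussianReal 0 (Real.toNNReal (α₀ ^ 2 / (2 * π)))).map
      fun e => LWE.discretize p (c + e)) := Measure.isProbabilityMeasure_map hmeas.aemeasurable
  rw [noiseZMod, ← PMF.toMeasure_apply_eq_toOuterMeasure_apply _ hS, Measure.toPMF_toMeasure,
    Measure.map_apply hmeas hS, measureReal_def]

omit [NeZero p] in
/-- `noiseZMod p α₀ 0 = Ψ̄_{α₀}`. [cite: RegevLWE2009, §2 (`Ψ̄_α`)] -/
theorem noiseZMod_zero [NeZero p] (α₀ : ℝ) : noiseZMod p α₀ 0 = LWE.discretizedGaussian p α₀ := by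
  unfold noiseZMod LWE.discretizedGaussian
  simp only [zero_add]

/-- **Regev's sample map** (Regev 2009, proof of Lemma 3.11: "We sample a vector `v ∈ L` from `D_{L,r}`,
and let `a = L⁻¹v mod p`. We then output `(a, ⟨x, v⟩/p + e mod 1)` where `e ∈ ℝ` is chosen according
to a normal distribution with standard deviation `α/(2√π)`"), with the second component DISCRETISED to
`ℤ_p` as the tree's `LWE` oracles expect (`⌊p·⌉ mod p`, Regev's `Ψ ↦ Ψ̄`, §2): the law of
`(L⁻¹v mod p, ⌊p(⟪x, v⟫/p + e)⌉ mod p)` for `v ← D_{L,r}` and `e ∼ N(0, α₀²/(2π))`; Regev's noise is the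
case `α₀ = α/√2`. [cite: RegevLWE2009, Lemma 3.11 (proof, Eq. (10))] -/
def bddLWESample (x : E) (r α₀ : ℝ) : PMF ((ι → ZMod p) × ZMod p) :=
  (discreteGaussian L r 0).bind fun v =>
    (noiseZMod p α₀ (⟪x, (v : E)⟫_ℝ / p)).map fun k => (coeffMod b p v, k)

end Sample

/-! ### Regev 2009, Lemma 3.11: the manufactured sample is close to `A_{s,Ψ̄_β}` -/

section Law

variable {E : Type*} [NormedAddCommGroup E] [InnerProductSpace ℝ E] [FiniteDimensional ℝ E]
  [MeasurableSpace E] [BorelSpace E]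
variable {L : Submodule ℤ E} [DiscreteTopology L] [IsZLattice ℝ L]
variable {ι : Type} [Fintype ι] [DecidableEq ι] (b : Basis ι ℤ L) (p : ℕ) [NeZero p]

omit [MeasurableSpace E] [BorelSpace E] [Fintype ι] [DecidableEq ι] in
/-- The parameter check of Regev's proof of Lemma 3.11 ("`1/√(1/r² + (√2‖x'‖/(pα))²) ≥ r/√2 >
η_ε(pL)`"): if `√2·p·η_ε(L) ≤ r` and `r‖x - κ‖ ≤ α₀ p` then, with `z = (x - κ)/p`,
`η_ε(pL) ≤ 1/√(1/r² + (‖z‖/α₀)²)` — the hypothesis of Cor. 3.10 for the lattice `pL`.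
[cite: RegevLWE2009, Lemma 3.11 (proof, last display)] -/
theorem smoothingParameter_smulLattice_le_one_div_sqrt {ε r α₀ : ℝ} (hε : 0 < ε) (hr : 0 < r)
    (hα : 0 < α₀) (hη : Real.sqrt 2 * p * smoothingParameter L ε ≤ r) {x κ : E}
    (hx : r * ‖x - κ‖ ≤ α₀ * p) :
    smoothingParameter (smulLattice b p) ε ≤
      1 / Real.sqrt (1 / r ^ 2 + (‖(p : ℝ)⁻¹ • (x - κ)‖ / α₀) ^ 2) := by
  have hp : (0 : ℝ) < p := Nat.cast_pos.2 (Nat.pos_of_ne_zero (NeZero.ne p))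
  have h2 : 0 < Real.sqrt 2 := Real.sqrt_pos.2 two_pos
  have h1 : smoothingParameter (smulLattice b p) ε ≤ r / Real.sqrt 2 := by
    refine (smoothingParameter_smulLattice_le b p hε).trans ?_
    rw [le_div_iff₀ h2]
    linarith [hη]
  have hzle : ‖(p : ℝ)⁻¹ • (x - κ)‖ / α₀ ≤ 1 / r := by
    rw [norm_smul, norm_inv, Real.norm_natCast, div_le_div_iff₀ hα hr]
    rw [inv_mul_eq_div, div_mul_eq_mul_div, div_le_iff₀ hp]
    linarith [hx]
  have hA2 : 1 / r ^ 2 + (‖(p : ℝ)⁻¹ • (x - κ)‖ / α₀) ^ 2 ≤ 2 / r ^ 2 := by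
    have h := pow_le_pow_left₀ (by positivity) hzle 2
    have h' : (1 / r : ℝ) ^ 2 = 1 / r ^ 2 := by rw [div_pow, one_pow]
    have h'' : (2 : ℝ) / r ^ 2 = 1 / r ^ 2 + 1 / r ^ 2 := by ring
    rw [h'] at h
    rw [h'']
    linarith
  have hApos : 0 < 1 / r ^ 2 + (‖(p : ℝ)⁻¹ • (x - κ)‖ / α₀) ^ 2 := by positivity
  have hsqrtA : Real.sqrt (1 / r ^ 2 + (‖(p : ℝ)⁻¹ • (x - κ)‖ / α₀) ^ 2) ≤ Real.sqrt 2 / r := by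
    calc Real.sqrt (1 / r ^ 2 + (‖(p : ℝ)⁻¹ • (x - κ)‖ / α₀) ^ 2)
        ≤ Real.sqrt (2 / r ^ 2) := Real.sqrt_le_sqrt hA2
      _ = Real.sqrt 2 / r := by rw [Real.sqrt_div (by norm_num : (0:ℝ) ≤ 2), Real.sqrt_sq hr.le]
  refine h1.trans ?_
  rw [div_le_div_iff₀ h2 (Real.sqrt_pos.2 hApos), one_mul]
  calc r * Real.sqrt (1 / r ^ 2 + (‖(p : ℝ)⁻¹ • (x - κ)‖ / α₀) ^ 2)
      ≤ r * (Real.sqrt 2 / r) := mul_le_mul_of_nonneg_left hsqrtA hr.le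
    _ = Real.sqrt 2 := by field_simp

omit [DecidableEq ι] in
/-- **The conditional law of the noise, per class `a`** (Regev 2009, proof of Lemma 3.11: "we condition
on any fixed value of `a` … the distribution of the remaining part `⟨x'/p, v⟩ + e` is within negligible
statistical distance of `Ψ_β` for `β = √((r‖x'‖/p)² + α²/2)` … by Corollary 3.10 … the distribution of
`v` is `D_{pL+La,r}`"). For `v = y + w` with `y ← D_{pL,r,-w}` (the discrete Gaussian of width `r` on the
coset `w + pL` of the class `a = L⁻¹w mod p`) and `e ∼ N(0, α₀²/(2π))`, the law of the second
component `⌊p(⟪x, v⟫/p + e)⌉ mod p` is within statistical distance `4ε` of `⟨a, s⟩ + Ψ̄_β`,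
`β = √((r‖x - κ‖/p)² + α₀²)`, provided `√2·p·η_ε(L) ≤ r` and `r‖x - κ‖ ≤ α₀p` (`κ ∈ L*`).
[cite: RegevLWE2009, Lemma 3.11 (proof) with Corollary 3.10] -/
theorem tvDist_noise_fibre_le {ε r α₀ : ℝ} (hε : 0 < ε) (hε' : ε ≤ 1 / 2) (hr : 0 < r)
    (hα : 0 < α₀) (hη : Real.sqrt 2 * p * smoothingParameter L ε ≤ r) {x κ : E}
    (hκ : κ ∈ dualLattice L) (hx : r * ‖x - κ‖ ≤ α₀ * p) (a : ι → ZMod p) (w : L)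
    (hw : coeffMod b p w = a) :
    (((discreteGaussian (smulLattice b p) r (-(w : E))).bind fun y =>
        noiseZMod p α₀ (⟪x, (y : E) + w⟫_ℝ / p)).tvDist
      ((LWE.discretizedGaussian p (Real.sqrt ((r * ‖x - κ‖ / p) ^ 2 + α₀ ^ 2))).map
        fun k => a ⬝ᵥ secretOf b p κ + k)) ≤ 4 * ε := by
  classical
  have hp : (p : ℝ) ≠ 0 := NeZero.ne (p : ℝ)
  set L₀ := smulLattice b p with hL₀
  set z : E := (p : ℝ)⁻¹ • (x - κ) with hz
  set s := secretOf b p κ with hs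
  set β : ℝ := Real.sqrt ((r * ‖x - κ‖ / p) ^ 2 + α₀ ^ 2) with hβ
  refine PMF.tvDist_le_of_forall_toOuterMeasure_sub_le _ _ fun S => ?_
  set B : Set ℝ := (fun t : ℝ => a ⬝ᵥ s + LWE.discretize p t) ⁻¹' S with hB
  have hBm : MeasurableSet B :=
    ((LWE.measurable_discretize p).const_add (a ⬝ᵥ s)) S.to_countable.measurableSet
  -- the event on the left, as sampled: a sum over the coset
  have hleft : ((((discreteGaussian L₀ r (-(w : E))).bind fun y =>
        noiseZMod p α₀ (⟪x, (y : E) + w⟫_ℝ / p)).toOuterMeasure S).toReal) =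
      ∑' y : L₀, (discreteGaussian L₀ r (-(w : E)) y).toReal *
        (gaussianReal 0 (Real.toNNReal (α₀ ^ 2 / (2 * π)))).real
          ((fun e : ℝ => ⟪z, (y : E) + w⟫_ℝ + e) ⁻¹' B) := by
    rw [PMF.toReal_toOuterMeasure_bind_apply]
    refine tsum_congr fun y => ?_
    rw [toReal_toOuterMeasure_noiseZMod]
    congr 2
    ext e
    set v : L := ⟨(y : E), smulLattice_le b p y.2⟩ + w with hv
    have hvE : (y : E) + w = (v : E) := rfl
    have hφv : coeffMod b p v = a := by
      rw [hv, map_add, hw, (coeffMod_eq_zero_iff b p _).2 y.2, zero_add]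
    simp only [Set.mem_preimage, hB]
    rw [hvE, discretize_inner_div_add b p hκ v e, hφv]
  -- the event on the right
  have hright : ((((LWE.discretizedGaussian p β).map fun k => a ⬝ᵥ s + k).toOuterMeasure S).toReal) =
      (gaussianReal 0 (Real.toNNReal (β ^ 2 / (2 * π)))).real B := by
    rw [PMF.toOuterMeasure_map_apply, ← noiseZMod_zero, toReal_toOuterMeasure_noiseZMod]
    congr 1
    ext e
    simp only [Set.mem_preimage, hB, zero_add]
  rw [hleft, hright]
  have hzβ : ‖z‖ ^ 2 * r ^ 2 + α₀ ^ 2 = β ^ 2 := by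
    rw [hβ, Real.sq_sqrt (by positivity), hz, norm_smul, norm_inv, Real.norm_natCast]
    field_simp
  have hcor := Regev2009.corollary_3_10 L₀ (w : E) z hε hε' hr hα
    (smoothingParameter_smulLattice_le_one_div_sqrt b p hε hr hα hη hx) hBm
  rw [hzβ] at hcor
  exact (le_abs_self _).trans hcor

omit [MeasurableSpace E] [BorelSpace E] [DecidableEq ι] in
/-- **The sample map, disintegrated along `a = L⁻¹v mod p`**: drawing `v ← D_{L,r}` and outputting
`(L⁻¹v mod p, ⌊p(⟪x, v⟫/p + e)⌉ mod p)` is the same as drawing the class `a` from its marginal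
`(L⁻¹· mod p)_* D_{L,r}`, then `v = y + rep a` with `y ← D_{pL,r,-rep a}`, then the noise.
[cite: RegevLWE2009, Lemma 3.11 (proof)] -/
theorem bddLWESample_eq_bind (rep : (ι → ZMod p) → L) (hrep : ∀ a, coeffMod b p (rep a) = a)
    (x : E) {r : ℝ} (hr : 0 < r) (α₀ : ℝ) :
    bddLWESample b p x r α₀ = ((discreteGaussian L r 0).map (coeffMod b p)).bind fun a =>
      (((discreteGaussian (smulLattice b p) r (-(rep a : E))).bind fun y =>
        noiseZMod p α₀ (⟪x, (y : E) + rep a⟫_ℝ / p)).map (Prod.mk a)) := by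
  have hker : ∀ v : L, coeffMod b p v = 0 ↔ (v : E) ∈ smulLattice b p := coeffMod_eq_zero_iff b p
  unfold bddLWESample
  conv_lhs => rw [discreteGaussian_eq_bind_fibre (smulLattice_le b p) (coeffMod b p) hker rep hrep hr 0]
  rw [PMF.bind_bind]
  refine congrArg _ (funext fun a => ?_)
  rw [PMF.bind_map, PMF.map_bind, zero_sub]
  refine congrArg _ (funext fun y => ?_)
  simp only [Function.comp_apply]
  have hφ : coeffMod b p ⟨(y : E) + rep a, add_mem (smulLattice_le b p y.2) (rep a).2⟩ = a := by
    have h : (⟨(y : E) + rep a, add_mem (smulLattice_le b p y.2) (rep a).2⟩ : L) =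
        ⟨(y : E), smulLattice_le b p y.2⟩ + rep a := rfl
    rw [h, map_add, hrep, (hker _).2 y.2, zero_add]
  rw [hφ]

omit [Fintype ι] [DecidableEq ι] [NeZero p] in
/-- `A_{s,χ}` disintegrated along `a`: `a` uniform, then `b = ⟨a, s⟩ + e`, `e ← χ`. [cite: RegevLWE2009, §2] -/
theorem lweSample_eq_bind [Fintype ι] [DecidableEq ι] [NeZero p] (χ : PMF (ZMod p)) (s : ι → ZMod p) :
    LWE.lweSample χ s = (PMF.uniformOfFintype (ι → ZMod p)).bind fun a =>
      (χ.map fun k => a ⬝ᵥ s + k).map (Prod.mk a) := by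
  unfold LWE.lweSample
  refine congrArg _ (funext fun a => ?_)
  rw [PMF.map_comp]
  rfl

/-- **Regev 2009, Lemma 3.11 (the distribution of the manufactured sample), discretised form.**
*"We claim that the distribution given by this procedure is within negligible statistical distance of
`A_{s,Ψ_β}` for some `β ≤ α`"* — here with explicit constants and Regev's `Ψ ↦ Ψ̄` discretisation
(§2) applied to the second component. Let `L` be a full-rank lattice with `ℤ`-basis `b`, `p ≥ 1`,
`0 < ε ≤ 1/2`, `0 < r` with `√2·p·η_ε(L) ≤ r`, `0 < α₀`, `κ ∈ L*` and `x` with `r·‖x - κ‖ ≤ α₀·p`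
(Regev: `x` within distance `αp/(√2 r)` of `L*`, `κ = κ_{L*}(x)`, `α₀ = α/√2`). Then the law of
`(L⁻¹v mod p, ⌊p(⟪x, v⟫/p + e)⌉ mod p)` for `v ← D_{L,r}`, `e ∼ N(0, α₀²/(2π))` (`bddLWESample`) is
within statistical distance `6ε` of the genuine `LWE` distribution `A_{s,Ψ̄_β}` (`LWE.lweSample` with
noise `LWE.discretizedGaussian p β`), where `s = (L*)⁻¹κ mod p` (`secretOf`) and
`β = √((r‖x - κ‖/p)² + α₀²)` (`≤ √2·α₀ = α` under the distance hypothesis). The `6ε` is `2ε` for the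
near-uniformity of `a` (the tree's GPV smoothing lemma over the sublattice `pL`, Regev: "the
distribution of `a` is very close to uniform … using `η_ε(pL) = pη_ε(L) < r` and Claim 3.8") plus `4ε`
for the noise (Cor. 3.10 on each coset `pL + La`, `tvDist_noise_fibre_le`).
[cite: RegevLWE2009, Lemma 3.11 (proof), with Claim 3.8 and Corollary 3.10] -/
theorem tvDist_bddLWESample_lweSample_le {ε r α₀ : ℝ} (hε : 0 < ε) (hε' : ε ≤ 1 / 2) (hr : 0 < r)
    (hα : 0 < α₀) (hη : Real.sqrt 2 * p * smoothingParameter L ε ≤ r) {x κ : E}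
    (hκ : κ ∈ dualLattice L) (hx : r * ‖x - κ‖ ≤ α₀ * p) :
    (bddLWESample b p x r α₀).tvDist
      (LWE.lweSample (LWE.discretizedGaussian p (Real.sqrt ((r * ‖x - κ‖ / p) ^ 2 + α₀ ^ 2)))
        (secretOf b p κ)) ≤ 6 * ε := by
  classical
  obtain ⟨rep, hrep⟩ : ∃ rep : (ι → ZMod p) → L, ∀ a, coeffMod b p (rep a) = a :=
    ⟨fun a => (coeffMod_surjective b p a).choose, fun a => (coeffMod_surjective b p a).choose_spec⟩
  have hker : ∀ v : L, coeffMod b p v = 0 ↔ (v : E) ∈ smulLattice b p := coeffMod_eq_zero_iff b p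
  set β : ℝ := Real.sqrt ((r * ‖x - κ‖ / p) ^ 2 + α₀ ^ 2) with hβ
  set s := secretOf b p κ with hs
  set P : PMF (ι → ZMod p) := (discreteGaussian L r 0).map (coeffMod b p) with hP
  set U : PMF (ι → ZMod p) := PMF.uniformOfFintype (ι → ZMod p) with hU
  set F : (ι → ZMod p) → PMF ((ι → ZMod p) × ZMod p) := fun a =>
    (((discreteGaussian (smulLattice b p) r (-(rep a : E))).bind fun y =>
      noiseZMod p α₀ (⟪x, (y : E) + rep a⟫_ℝ / p)).map (Prod.mk a)) with hF
  set G : (ι → ZMod p) → PMF ((ι → ZMod p) × ZMod p) := fun a =>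
    ((LWE.discretizedGaussian p β).map fun k => a ⬝ᵥ s + k).map (Prod.mk a) with hG
  have h0 : bddLWESample b p x r α₀ = P.bind F := bddLWESample_eq_bind b p rep hrep x hr α₀
  have hT : LWE.lweSample (LWE.discretizedGaussian p β) s = U.bind G := lweSample_eq_bind p _ s
  -- near-uniformity of `a` (GPV over the sublattice `pL`, `η_ε(pL) ≤ r`)
  have hηr : smoothingParameter (smulLattice b p) ε ≤ r := by
    refine (smoothingParameter_smulLattice_le b p hε).trans ?_
    have h2 : 1 ≤ Real.sqrt 2 := Real.one_le_sqrt.2 (by norm_num)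
    have hη0 : 0 ≤ (p : ℝ) * smoothingParameter L ε :=
      mul_nonneg (Nat.cast_nonneg _) (smoothingParameter_nonneg L ε)
    nlinarith
  have h1 : (P.bind F).tvDist (U.bind F) ≤ 2 * ε :=
    (PMF.tvDist_bind_left_le P U F).trans
      (tvDist_map_discreteGaussian_uniformOfFintype_le_two_mul (smulLattice_le b p) (coeffMod b p)
        (coeffMod_surjective b p) hker hε hr hηr 0)
  -- the noise, per class
  have h2 : (U.bind F).tvDist (U.bind G) ≤ 4 * ε := by
    refine PMF.tvDist_bind_le_of_forall_le U F G fun a => ?_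
    refine (PMF.tvDist_map_le_holds (Prod.mk a) _ _).trans ?_
    exact tvDist_noise_fibre_le b p hε hε' hr hα hη hκ hx a (rep a) (hrep a)
  rw [h0, hT]
  calc (P.bind F).tvDist (U.bind G)
      ≤ (P.bind F).tvDist (U.bind F) + (U.bind F).tvDist (U.bind G) := PMF.tvDist_triangle_holds _ _ _
    _ ≤ 2 * ε + 4 * ε := add_le_add h1 h2
    _ = 6 * ε := by ring

omit [InnerProductSpace ℝ E] [FiniteDimensional ℝ E] [MeasurableSpace E] [BorelSpace E]
  [DiscreteTopology L] [IsZLattice ℝ L] [Fintype ι] [DecidableEq ι] in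
/-- **`β ≤ α`**: under the distance hypothesis `r‖x - κ‖ ≤ α₀p` the noise parameter of the manufactured
sample satisfies `β = √((r‖x - κ‖/p)² + α₀²) ≤ √2·α₀` (`= α` for Regev's `α₀ = α/√2`), as required by
Lemma 3.7 ("for some (unknown) `β ≤ α`"). [cite: RegevLWE2009, Lemma 3.11 (proof: "`β ≤ α`")] -/
theorem noiseParam_le {r α₀ : ℝ} (hα : 0 < α₀) {x κ : E} (hx : r * ‖x - κ‖ ≤ α₀ * p)
    (hx0 : 0 ≤ r * ‖x - κ‖) :
    Real.sqrt ((r * ‖x - κ‖ / p) ^ 2 + α₀ ^ 2) ≤ Real.sqrt 2 * α₀ := by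
  have hp : (0 : ℝ) < p := Nat.cast_pos.2 (Nat.pos_of_ne_zero (NeZero.ne p))
  have h1 : r * ‖x - κ‖ / p ≤ α₀ := by rw [div_le_iff₀ hp]; exact hx
  have h0 : 0 ≤ r * ‖x - κ‖ / p := div_nonneg hx0 hp.le
  rw [show Real.sqrt 2 * α₀ = Real.sqrt (2 * α₀ ^ 2) by
    rw [Real.sqrt_mul' _ (sq_nonneg _), Real.sqrt_sq hα.le]]
  exact Real.sqrt_le_sqrt (by nlinarith)

end Law

end Regev2009

end Literature.Computability.Cryptography
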